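import Summits.CriticalPhenomena.PercolationContinuityZ3.Theorems.PercNearOneGluingNoHeavyConstsClusterSquareApicesLinked
import HarnessLib

/-!
# The hub–hub endgame for an outerplanar graph with SEVERAL independent apices

builds on p205010 (kernel theorem, internal audit signed; external expert review pending)

PAPER-2 track "percolation constants", part (ii), seat `prim-consts-1`, gen 20 (lane index
`run/shared/lean/prim/consts/CONSTANTS.md`, row A19; memo `FROM-prim-consts-1-g20-APEX-FACE.md` §0(4), §3(iii)).
Support file for the crux `NoHeavyLowerTail` (stmt-CriticalPhenomena-4575; `--supports`).  Theorems only; no definitions, no sorries.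

Setting of `…ConstsClusterSquareApicesGap/…ApicesLinked` (hub predicate, rim positions, `G₀`, `Hp S`, `C x`), plus two hypotheses
relating different hubs: (L) no chord of one hub interleaves a chord of another hub (`xCC`), and (L2) two distinct hubs have at most two
common neighbours (`hL2`).  `Consts.Apices.false_of_linked_hubs`: an `H`-connected `K ∋ a` with two HUBS `h₁ ≠ h₂ ∉ K` as clash vertices
(rim `K`-neighbours `k₁ ~ h₁`, `k₂ ~ h₂`) cannot carry both linkages `(h₁ → b, h₂ → c)`, `(h₁ → c, h₂ → b)` (walks avoiding `K`, disjoint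
within each pair, `b ≠ c` on the rim).  PROOF: with `x₁, x₃, x₂, x₄` the second vertices of the four walks (rim neighbours of `h₁, h₂, h₁,
h₂`), the master lemma puts `x₁, x₂, x₃, x₄, b, c` in one gap of `K` (the hub step at `h₁` links the two triples); the sets
`K ∪ supp(W)` give eight non-betweenness facts which make the intervals `[x₁,b] / [x₃,c]` and `[x₂,c] / [x₄,b]` pairwise separated
(`arith_J`); (L) at the chords `{x₁,x₂}, {k₁,xᵢ} ∈ C h₁` versus `{x₃,x₄}, {k₂,xⱼ} ∈ C h₂` (`sep_aux`) separates `{x₁,x₂}` from `{x₃,x₄}`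
weakly (`arith_sep`) unless `{x₁,x₂} = {x₃,x₄}`, in which case either `k₁ = k₂` contradicts (L2) or the chords from `k₁, k₂` interleave;
the separated case contradicts the interval facts by `omega`.  The order system was first checked infeasible by brute force (memo §0(4)).
References: N. Gladkov, arXiv:2408.08457v2 (2024); G. Chartrand, F. Harary, Ann. Inst. H. Poincaré B 3 (1967) 433–438.
-/

noncomputable section

open Classical

namespace Summit.CriticalPhenomena.PercolationContinuityZ3.Theorems

open MeasureTheory Finset Literature.Probability.LatticeModels Literature.Probability.Percolation

namespace Consts

namespace Apices

variable {n m : ℕ} {pos : Fin n → Fin m} {hub : Fin n → Prop}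

/-- Order fact: from the four "no hub-neighbour strictly between two neighbours of the other hub" facts, the pairs `{X1,X2}` and `{X3,X4}`
are weakly separated, or coincide crosswise. [folklore] -/
private theorem arith_sep {X1 X2 X3 X4 : ℕ} (d24 : X2 ≠ X4)
    (s1 : ¬ (X1 < X3 ∧ X3 < X2) ∧ ¬ (X2 < X3 ∧ X3 < X1)) (s2 : ¬ (X1 < X4 ∧ X4 < X2) ∧ ¬ (X2 < X4 ∧ X4 < X1))
    (s3 : ¬ (X3 < X1 ∧ X1 < X4) ∧ ¬ (X4 < X1 ∧ X1 < X3)) (s4 : ¬ (X3 < X2 ∧ X2 < X4) ∧ ¬ (X4 < X2 ∧ X2 < X3)) :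
    (X3 ≤ X1 ∧ X3 ≤ X2 ∧ X4 ≤ X1 ∧ X4 ≤ X2) ∨ (X1 ≤ X3 ∧ X2 ≤ X3 ∧ X1 ≤ X4 ∧ X2 ≤ X4) ∨ (X1 = X4 ∧ X2 = X3) := by
  omega

/-- Order fact: two intervals `[U,P]`, `[V,Q]` with `P ≠ V, Q` and `U ≠ …` such that no endpoint of one lies strictly inside the other
are separated in the order of `U, V`. [folklore] -/
private theorem arith_J {U P V Q : ℕ} (dPV : P ≠ V) (dPQ : P ≠ Q)
    (h1 : ¬ (V < U ∧ U < Q) ∧ ¬ (Q < U ∧ U < V)) (h2 : ¬ (V < P ∧ P < Q) ∧ ¬ (Q < P ∧ P < V))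
    (h3 : ¬ (U < V ∧ V < P) ∧ ¬ (P < V ∧ V < U)) (h4 : ¬ (U < Q ∧ Q < P) ∧ ¬ (P < Q ∧ Q < U)) :
    (U < V → P < Q) ∧ (V < U → Q < P) := by
  omega

/-- Order fact: a value different from `X1, X2` and not strictly between them (for `X1 < X2`) is below `X1` or above `X2`. [folklore] -/
private theorem outside_of {K X1 X2 : ℕ} (g : ¬ (X1 < K ∧ K < X2)) (d1 : K ≠ X1) (d2 : K ≠ X2) :
    K < X1 ∨ X2 < K := by
  omega

section Endgame

variable {H G₀ : SimpleGraph (Fin n)} {Hp : Set (Fin n) → SimpleGraph (Fin n)} {C : Fin n → SimpleGraph (Fin n)} {a : Fin n}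
  (hpos : ∀ u v, ¬ hub u → ¬ hub v → pos u = pos v → u = v)
  (hI : ∀ u v, hub u → hub v → ¬ H.Adj u v)
  (g1 : ∀ u v, H.Adj u v → ¬ hub u → ¬ hub v → G₀.Adj u v)
  (g2 : ∀ S u v, H.Adj u v → ¬ hub u → ¬ hub v → (Hp S).Adj u v)
  (g3 : ∀ (S : Set (Fin n)) x u v, hub x → x ∈ S → u ≠ v → ¬ hub u → ¬ hub v → H.Adj x u → H.Adj x v → (Hp S).Adj u v)
  (c1 : ∀ x u v, hub x → u ≠ v → ¬ hub u → ¬ hub v → H.Adj x u → H.Adj x v → (C x).Adj u v)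
  (x0 : ∀ (S : Set (Fin n)) p q r s, (Hp S).Adj p q → G₀.Adj r s → (pos p - pos a).val < (pos r - pos a).val →
    (pos r - pos a).val < (pos q - pos a).val → (pos q - pos a).val < (pos s - pos a).val → False)
  (x0' : ∀ (S : Set (Fin n)) p q r s, G₀.Adj p q → (Hp S).Adj r s → (pos p - pos a).val < (pos r - pos a).val →
    (pos r - pos a).val < (pos q - pos a).val → (pos q - pos a).val < (pos s - pos a).val → False)
  (xC : ∀ (S : Set (Fin n)) x p q r s, hub x → x ∉ S → (Hp S).Adj p q → (C x).Adj r s →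
    (pos p - pos a).val < (pos r - pos a).val → (pos r - pos a).val < (pos q - pos a).val →
    (pos q - pos a).val < (pos s - pos a).val → False)
  (xC' : ∀ (S : Set (Fin n)) x p q r s, hub x → x ∉ S → (C x).Adj p q → (Hp S).Adj r s →
    (pos p - pos a).val < (pos r - pos a).val → (pos r - pos a).val < (pos q - pos a).val →
    (pos q - pos a).val < (pos s - pos a).val → False)
  (xCC : ∀ x x' p q r s, hub x → hub x' → x ≠ x' → (C x).Adj p q → (C x').Adj r s →
    (pos p - pos a).val < (pos r - pos a).val → (pos r - pos a).val < (pos q - pos a).val →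
    (pos q - pos a).val < (pos s - pos a).val → False)
  (ha : ¬ hub a)
include hpos hI g1 g2 g3 c1 x0 x0' xC xC' xCC ha

omit hpos hI g1 g2 g3 x0 x0' xC xC' ha in
/-- (L) in use: if `u, v` are rim neighbours of the hub `x` and `w, k'` rim neighbours of another hub `x'` with `k'` not strictly between
`u` and `v` (and at neither position), then `w` is not strictly between `u` and `v` either — else the chords `{u,v} ∈ C x` and
`{k',w} ∈ C x'` interleave. [folklore] -/
theorem sep_aux {x x' u v w k' : Fin n} (hx : hub x) (hx' : hub x') (hxx' : x ≠ x') (hu : ¬ hub u) (hv : ¬ hub v)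
    (hw : ¬ hub w) (hk' : ¬ hub k') (hxu : H.Adj x u) (hxv : H.Adj x v) (hx'w : H.Adj x' w) (hx'k : H.Adj x' k') (hkw : k' ≠ w)
    (hkuv : ¬ ((pos u - pos a).val < (pos k' - pos a).val ∧ (pos k' - pos a).val < (pos v - pos a).val) ∧
      ¬ ((pos v - pos a).val < (pos k' - pos a).val ∧ (pos k' - pos a).val < (pos u - pos a).val))
    (hku : (pos k' - pos a).val ≠ (pos u - pos a).val) (hkv : (pos k' - pos a).val ≠ (pos v - pos a).val) :
    ¬ ((pos u - pos a).val < (pos w - pos a).val ∧ (pos w - pos a).val < (pos v - pos a).val) ∧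
      ¬ ((pos v - pos a).val < (pos w - pos a).val ∧ (pos w - pos a).val < (pos u - pos a).val) := by
  have hC2 : (C x').Adj k' w := c1 x' k' w hx' hkw hk' hw hx'k hx'w
  constructor
  · rintro ⟨l1, l2⟩
    have huv : u ≠ v := fun e => by rw [e] at l1; omega
    have hC1 : (C x).Adj u v := c1 x u v hx huv hu hv hxu hxv
    rcases Nat.lt_or_gt_of_ne hku with hk | hk
    · exact xCC x' x k' w u v hx' hx hxx'.symm hC2 hC1 hk l1 l2
    · exact xCC x x' u v w k' hx hx' hxx' hC1 hC2.symm l1 l2 (by omega)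
  · rintro ⟨l1, l2⟩
    have huv : v ≠ u := fun e => by rw [e] at l1; omega
    have hC1 : (C x).Adj v u := c1 x v u hx huv hv hu hxv hxu
    rcases Nat.lt_or_gt_of_ne hkv with hk | hk
    · exact xCC x' x k' w v u hx' hx hxx'.symm hC2 hC1 hk l1 l2
    · exact xCC x x' v u w k' hx hx' hxx' hC1 hC2.symm l1 l2 (by omega)

/-- HUB–HUB ENDGAME (several apices): an `H`-connected `K ∋ a` with two distinct HUBS `h₁ ∉ K`, `h₂` as clash vertices (rim `K`-neighbours
`k₁ ~ h₁`, `k₂ ~ h₂`) cannot carry both linkages `(h₁ → b, h₂ → c)` and `(h₁ → c, h₂ → b)` by walks avoiding `K`, disjoint within each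
pair (`b ≠ c` on the rim), given (L) `xCC` and (L2) `hL2` (two hubs share at most two neighbours). [folklore: Jordan curve] -/
theorem false_of_linked_hubs (hL2 : ∀ x x' u v w, hub x → hub x' → x ≠ x' → u ≠ v → u ≠ w → v ≠ w →
      H.Adj x u → H.Adj x v → H.Adj x w → H.Adj x' u → H.Adj x' v → H.Adj x' w → False)
    {K : Set (Fin n)} (hKw : ∀ s ∈ K, ∃ W : H.Walk a s, ∀ v ∈ W.support, v ∈ K)
    {h₁ h₂ b c k₁ k₂ : Fin n} (hh₁ : hub h₁) (hh₂ : hub h₂) (h12 : h₁ ≠ h₂) (hh₁K : h₁ ∉ K)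
    (hb : ¬ hub b) (hc : ¬ hub c) (hbc : b ≠ c)
    (hk₁K : k₁ ∈ K) (hk₁h : ¬ hub k₁) (hk₁ : H.Adj h₁ k₁) (hk₂K : k₂ ∈ K) (hk₂h : ¬ hub k₂) (hk₂ : H.Adj h₂ k₂)
    (W₁ : H.Walk h₁ b) (W₂ : H.Walk h₂ c) (hW₁ : ∀ x ∈ W₁.support, x ∉ K) (hW₂ : ∀ x ∈ W₂.support, x ∉ K)
    (hWd : ∀ x, x ∈ W₁.support → x ∉ W₂.support)
    (W₃ : H.Walk h₁ c) (W₄ : H.Walk h₂ b) (hW₃ : ∀ x ∈ W₃.support, x ∉ K) (hW₄ : ∀ x ∈ W₄.support, x ∉ K)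
    (hWd' : ∀ x, x ∈ W₃.support → x ∉ W₄.support) : False := by
  cases W₁ with
  | nil => exact hb hh₁
  | @cons _ x₁ _ hx₁ W₁' =>
  cases W₂ with
  | nil => exact hc hh₂
  | @cons _ x₃ _ hx₃ W₂' =>
  cases W₃ with
  | nil => exact hc hh₁
  | @cons _ x₂ _ hx₂ W₃' =>
  cases W₄ with
  | nil => exact hb hh₂
  | @cons _ x₄ _ hx₄ W₄' =>
  -- the second vertices are rim neighbours of the hubs, outside `K`
  have hx₁h : ¬ hub x₁ := fun e => hI h₁ x₁ hh₁ e hx₁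
  have hx₂h : ¬ hub x₂ := fun e => hI h₁ x₂ hh₁ e hx₂
  have hx₃h : ¬ hub x₃ := fun e => hI h₂ x₃ hh₂ e hx₃
  have hx₄h : ¬ hub x₄ := fun e => hI h₂ x₄ hh₂ e hx₄
  have hx₁W : x₁ ∈ (SimpleGraph.Walk.cons hx₁ W₁').support := by simp
  have hx₃W : x₃ ∈ (SimpleGraph.Walk.cons hx₃ W₂').support := by simp
  have hx₂W : x₂ ∈ (SimpleGraph.Walk.cons hx₂ W₃').support := by simp
  have hx₄W : x₄ ∈ (SimpleGraph.Walk.cons hx₄ W₄').support := by simp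
  have hbW₁ : b ∈ (SimpleGraph.Walk.cons hx₁ W₁').support := SimpleGraph.Walk.end_mem_support _
  have hcW₂ : c ∈ (SimpleGraph.Walk.cons hx₃ W₂').support := SimpleGraph.Walk.end_mem_support _
  have hcW₃ : c ∈ (SimpleGraph.Walk.cons hx₂ W₃').support := SimpleGraph.Walk.end_mem_support _
  have hbW₄ : b ∈ (SimpleGraph.Walk.cons hx₄ W₄').support := SimpleGraph.Walk.end_mem_support _
  have hx₁K : x₁ ∉ K := hW₁ x₁ hx₁W
  have hx₂K : x₂ ∉ K := hW₃ x₂ hx₂W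
  have hx₃K : x₃ ∉ K := hW₂ x₃ hx₃W
  have hx₄K : x₄ ∉ K := hW₄ x₄ hx₄W
  have hbK : b ∉ K := hW₁ b hbW₁
  have hcK : c ∉ K := hW₂ c hcW₂
  -- vertex disequalities
  have n13 : x₁ ≠ x₃ := fun e => hWd x₁ hx₁W (e ▸ hx₃W)
  have n1c : x₁ ≠ c := fun e => hWd x₁ hx₁W (e ▸ hcW₂)
  have nb3 : b ≠ x₃ := fun e => hWd b hbW₁ (e ▸ hx₃W)
  have n24 : x₂ ≠ x₄ := fun e => hWd' x₂ hx₂W (e ▸ hx₄W)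
  have n2b : x₂ ≠ b := fun e => hWd' x₂ hx₂W (e ▸ hbW₄)
  have nc4 : c ≠ x₄ := fun e => hWd' c hcW₃ (e ▸ hx₄W)
  have nk₁ : ∀ v, v ∉ K → k₁ ≠ v := fun v hv e => hv (e ▸ hk₁K)
  have nk₂ : ∀ v, v ∉ K → k₂ ≠ v := fun v hv e => hv (e ▸ hk₂K)
  -- position disequalities (cut open at `a`)
  have P : ∀ u v : Fin n, ¬ hub u → ¬ hub v → u ≠ v → (pos u - pos a).val ≠ (pos v - pos a).val :=
    fun u v hu hv huv e => huv (hpos u v hu hv (NonCrossing.rot_injective (pos a) e))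
  have dbc := P b c hb hc hbc
  have d13 := P x₁ x₃ hx₁h hx₃h n13
  have d1c := P x₁ c hx₁h hc n1c
  have db3 := P b x₃ hb hx₃h nb3
  have d24 := P x₂ x₄ hx₂h hx₄h n24
  have d2b := P x₂ b hx₂h hb n2b
  have dc4 := P c x₄ hc hx₄h nc4
  have dk₁1 := P k₁ x₁ hk₁h hx₁h (nk₁ x₁ hx₁K)
  have dk₁2 := P k₁ x₂ hk₁h hx₂h (nk₁ x₂ hx₂K)
  have dk₁3 := P k₁ x₃ hk₁h hx₃h (nk₁ x₃ hx₃K)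
  have dk₁4 := P k₁ x₄ hk₁h hx₄h (nk₁ x₄ hx₄K)
  have dk₂1 := P k₂ x₁ hk₂h hx₁h (nk₂ x₁ hx₁K)
  have dk₂2 := P k₂ x₂ hk₂h hx₂h (nk₂ x₂ hx₂K)
  have dk₂3 := P k₂ x₃ hk₂h hx₃h (nk₂ x₃ hx₃K)
  have dk₂4 := P k₂ x₄ hk₂h hx₄h (nk₂ x₄ hx₄K)
  -- (1) one gap of `K`: the counts of x₁, b (W₁), x₃, c (W₂), x₂, c (W₃), x₄, b (W₄) agree, and x₁ ~ x₂ through the hub h₁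
  have e1 := cnt_eq_of_walk hpos hI g1 g2 g3 c1 x0 x0' xC xC' ha hKw (S' := {v | v ∈ K ∧ ¬ hub v}) (fun _ => Iff.rfl)
    (SimpleGraph.Walk.cons hx₁ W₁') hW₁ x₁ hx₁W b hbW₁ hx₁h hb
  have e2 := cnt_eq_of_walk hpos hI g1 g2 g3 c1 x0 x0' xC xC' ha hKw (S' := {v | v ∈ K ∧ ¬ hub v}) (fun _ => Iff.rfl)
    (SimpleGraph.Walk.cons hx₃ W₂') hW₂ x₃ hx₃W c hcW₂ hx₃h hc
  have e3 := cnt_eq_of_walk hpos hI g1 g2 g3 c1 x0 x0' xC xC' ha hKw (S' := {v | v ∈ K ∧ ¬ hub v}) (fun _ => Iff.rfl)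
    (SimpleGraph.Walk.cons hx₂ W₃') hW₃ x₂ hx₂W c hcW₃ hx₂h hc
  have e4 := cnt_eq_of_walk hpos hI g1 g2 g3 c1 x0 x0' xC xC' ha hKw (S' := {v | v ∈ K ∧ ¬ hub v}) (fun _ => Iff.rfl)
    (SimpleGraph.Walk.cons hx₄ W₄') hW₄ x₄ hx₄W b hbW₄ hx₄h hb
  have e5 := cnt_eq_of_hubAdj hpos hI g2 g3 c1 xC xC' ha hKw (S' := {v | v ∈ K ∧ ¬ hub v}) (fun _ => Iff.rfl) hh₁ hh₁K
    hx₁K hx₂K hx₁h hx₂h hx₁ hx₂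
  -- k₂ is not strictly between x₁, x₂; k₁ not strictly between x₃, x₄; k₁, k₂ not strictly between x₁, x₂ / x₃, x₄
  have g12 := NonCrossing.not_between_of_cnt_eq_pos' a _ e5 ⟨hk₂K, hk₂h⟩
  have g12' := NonCrossing.not_between_of_cnt_eq_pos' a _ e5 ⟨hk₁K, hk₁h⟩
  have g34 := NonCrossing.not_between_of_cnt_eq_pos' a _ (e2.trans (e3.symm.trans (e5.symm.trans (e1.trans e4.symm))))
    ⟨hk₁K, hk₁h⟩
  have g34' := NonCrossing.not_between_of_cnt_eq_pos' a _ (e2.trans (e3.symm.trans (e5.symm.trans (e1.trans e4.symm))))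
    ⟨hk₂K, hk₂h⟩
  -- (2) the four `K ∪ supp` sets: interval facts
  have hS₁ := NonCrossing.walks_extend hKw hk₁K hk₁.symm (SimpleGraph.Walk.cons hx₁ W₁')
  have hS₂ := NonCrossing.walks_extend hKw hk₂K hk₂.symm (SimpleGraph.Walk.cons hx₃ W₂')
  have hS₃ := NonCrossing.walks_extend hKw hk₁K hk₁.symm (SimpleGraph.Walk.cons hx₂ W₃')
  have hS₄ := NonCrossing.walks_extend hKw hk₂K hk₂.symm (SimpleGraph.Walk.cons hx₄ W₄')
  have f1 := cnt_eq_of_walk hpos hI g1 g2 g3 c1 x0 x0' xC xC' ha hS₁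
    (S' := {v | v ∈ K ∪ {v | v ∈ (SimpleGraph.Walk.cons hx₁ W₁').support} ∧ ¬ hub v}) (fun _ => Iff.rfl)
    (SimpleGraph.Walk.cons hx₃ W₂') (fun v hv hvS => by
      rcases hvS with hvK | hvW
      · exact hW₂ v hv hvK
      · exact hWd v hvW hv) x₃ hx₃W c hcW₂ hx₃h hc
  have f2 := cnt_eq_of_walk hpos hI g1 g2 g3 c1 x0 x0' xC xC' ha hS₂
    (S' := {v | v ∈ K ∪ {v | v ∈ (SimpleGraph.Walk.cons hx₃ W₂').support} ∧ ¬ hub v}) (fun _ => Iff.rfl)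
    (SimpleGraph.Walk.cons hx₁ W₁') (fun v hv hvS => by
      rcases hvS with hvK | hvW
      · exact hW₁ v hv hvK
      · exact hWd v hv hvW) x₁ hx₁W b hbW₁ hx₁h hb
  have f3 := cnt_eq_of_walk hpos hI g1 g2 g3 c1 x0 x0' xC xC' ha hS₃
    (S' := {v | v ∈ K ∪ {v | v ∈ (SimpleGraph.Walk.cons hx₂ W₃').support} ∧ ¬ hub v}) (fun _ => Iff.rfl)
    (SimpleGraph.Walk.cons hx₄ W₄') (fun v hv hvS => by
      rcases hvS with hvK | hvW
      · exact hW₄ v hv hvK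
      · exact hWd' v hvW hv) x₄ hx₄W b hbW₄ hx₄h hb
  have f4 := cnt_eq_of_walk hpos hI g1 g2 g3 c1 x0 x0' xC xC' ha hS₄
    (S' := {v | v ∈ K ∪ {v | v ∈ (SimpleGraph.Walk.cons hx₄ W₄').support} ∧ ¬ hub v}) (fun _ => Iff.rfl)
    (SimpleGraph.Walk.cons hx₂ W₃') (fun v hv hvS => by
      rcases hvS with hvK | hvW
      · exact hW₃ v hv hvK
      · exact hWd' v hv hvW) x₂ hx₂W c hcW₃ hx₂h hc
  -- interval [x₁,b] vs [x₃,c]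
  have i1 := NonCrossing.not_between_of_cnt_eq_pos' a _ f1 ⟨Or.inr hx₁W, hx₁h⟩   -- x₁ ∉ (x₃,c)
  have i1' := NonCrossing.not_between_of_cnt_eq_pos' a _ f1 ⟨Or.inr hbW₁, hb⟩    -- b ∉ (x₃,c)
  have i2 := NonCrossing.not_between_of_cnt_eq_pos' a _ f2 ⟨Or.inr hx₃W, hx₃h⟩   -- x₃ ∉ (x₁,b)
  have i2' := NonCrossing.not_between_of_cnt_eq_pos' a _ f2 ⟨Or.inr hcW₂, hc⟩    -- c ∉ (x₁,b)
  -- interval [x₂,c] vs [x₄,b]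
  have i3 := NonCrossing.not_between_of_cnt_eq_pos' a _ f3 ⟨Or.inr hx₂W, hx₂h⟩   -- x₂ ∉ (x₄,b)
  have i3' := NonCrossing.not_between_of_cnt_eq_pos' a _ f3 ⟨Or.inr hcW₃, hc⟩    -- c ∉ (x₄,b)
  have i4 := NonCrossing.not_between_of_cnt_eq_pos' a _ f4 ⟨Or.inr hx₄W, hx₄h⟩   -- x₄ ∉ (x₂,c)
  have i4' := NonCrossing.not_between_of_cnt_eq_pos' a _ f4 ⟨Or.inr hbW₄, hb⟩    -- b ∉ (x₂,c)
  have J₁ := arith_J db3 dbc i1 i1' i2 i2'       -- U = x₁, P = b, V = x₃, Q = c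
  have J₂ := arith_J dc4 dbc.symm i3 i3' i4 i4'          -- U = x₂, P = c, V = x₄, Q = b
  -- (3) (L): hub-neighbours of one hub are not strictly between two neighbours of the other
  have s1 := sep_aux c1 xCC hh₁ hh₂ h12 hx₁h hx₂h hx₃h hk₂h hx₁ hx₂ hx₃ hk₂ (nk₂ x₃ hx₃K) g12 dk₂1 dk₂2
  have s2 := sep_aux c1 xCC hh₁ hh₂ h12 hx₁h hx₂h hx₄h hk₂h hx₁ hx₂ hx₄ hk₂ (nk₂ x₄ hx₄K) g12 dk₂1 dk₂2
  have s3 := sep_aux c1 xCC hh₂ hh₁ h12.symm hx₃h hx₄h hx₁h hk₁h hx₃ hx₄ hx₁ hk₁ (nk₁ x₁ hx₁K) g34 dk₁3 dk₁4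
  have s4 := sep_aux c1 xCC hh₂ hh₁ h12.symm hx₃h hx₄h hx₂h hk₁h hx₃ hx₄ hx₂ hk₁ (nk₁ x₂ hx₂K) g34 dk₁3 dk₁4
  rcases arith_sep d24 s1 s2 s3 s4 with hsep | hsep | ⟨e14, e23⟩
  · -- x₃, x₄ weakly below x₁, x₂: then c < b from [x₁,b] ⊥ [x₃,c] and b < c from [x₂,c] ⊥ [x₄,b]
    have l1 := J₁.2 (lt_of_le_of_ne hsep.1 d13.symm)
    have l2 := J₂.2 (lt_of_le_of_ne hsep.2.2.2 d24.symm)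
    exact absurd (l1.trans l2) (lt_irrefl _)
  · have l1 := J₁.1 (lt_of_le_of_ne hsep.1 d13)
    have l2 := J₂.1 (lt_of_le_of_ne hsep.2.2.2 d24)
    exact absurd (l1.trans l2) (lt_irrefl _)
  · -- the crosswise tie `x₁ = x₄`, `x₂ = x₃`
    have v14 : x₁ = x₄ := hpos x₁ x₄ hx₁h hx₄h (NonCrossing.rot_injective (pos a) e14)
    have v23 : x₂ = x₃ := hpos x₂ x₃ hx₂h hx₃h (NonCrossing.rot_injective (pos a) e23)
    have n12 : x₁ ≠ x₂ := fun e => n13 (e.trans v23)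
    by_cases hk : k₁ = k₂
    · subst hk
      exact hL2 h₁ h₂ k₁ x₁ x₂ hh₁ hh₂ h12 (nk₁ x₁ hx₁K) (nk₁ x₂ hx₂K) n12 hk₁ hx₁ hx₂ hk₂ (v14 ▸ hx₄) (v23 ▸ hx₃)
    · have dk := P k₁ k₂ hk₁h hk₂h hk
      have d12 := P x₁ x₂ hx₁h hx₂h n12
      have C11 : (C h₁).Adj k₁ x₁ := c1 h₁ k₁ x₁ hh₁ (nk₁ x₁ hx₁K) hk₁h hx₁h hk₁ hx₁
      have C12 : (C h₁).Adj k₁ x₂ := c1 h₁ k₁ x₂ hh₁ (nk₁ x₂ hx₂K) hk₁h hx₂h hk₁ hx₂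
      have C21 : (C h₂).Adj k₂ x₁ := c1 h₂ k₂ x₁ hh₂ (nk₂ x₁ hx₁K) hk₂h hx₁h hk₂ (v14 ▸ hx₄)
      have C22 : (C h₂).Adj k₂ x₂ := c1 h₂ k₂ x₂ hh₂ (nk₂ x₂ hx₂K) hk₂h hx₂h hk₂ (v23 ▸ hx₃)
      -- k₁, k₂ lie outside the interval spanned by x₁, x₂ (facts g12, g12'); eight order cases, each an interleaving
      obtain ⟨g12a, g12b⟩ := g12
      obtain ⟨g12a', g12b'⟩ := g12'
      rcases Nat.lt_or_gt_of_ne d12 with h12p | h12p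
      · -- x₁ < x₂
        have hk₁s := outside_of g12a' dk₁1 dk₁2
        have hk₂s := outside_of g12a dk₂1 dk₂2
        rcases hk₁s with l₁ | l₁ <;> rcases hk₂s with l₂ | l₂
        · rcases Nat.lt_or_gt_of_ne dk with l | l
          · exact xCC h₁ h₂ k₁ x₁ k₂ x₂ hh₁ hh₂ h12 C11 C22 l l₂ h12p
          · exact xCC h₂ h₁ k₂ x₁ k₁ x₂ hh₂ hh₁ h12.symm C21 C12 l l₁ h12p
        · exact xCC h₁ h₂ k₁ x₂ x₁ k₂ hh₁ hh₂ h12 C12 C21.symm l₁ h12p l₂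
        · exact xCC h₂ h₁ k₂ x₂ x₁ k₁ hh₂ hh₁ h12.symm C22 C11.symm l₂ h12p l₁
        · rcases Nat.lt_or_gt_of_ne dk with l | l
          · exact xCC h₁ h₂ x₁ k₁ x₂ k₂ hh₁ hh₂ h12 C11.symm C22.symm h12p l₁ l
          · exact xCC h₂ h₁ x₁ k₂ x₂ k₁ hh₂ hh₁ h12.symm C21.symm C12.symm h12p l₂ l
      · -- x₂ < x₁
        have hk₁s := outside_of g12b' dk₁2 dk₁1
        have hk₂s := outside_of g12b dk₂2 dk₂1
        rcases hk₁s with l₁ | l₁ <;> rcases hk₂s with l₂ | l₂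
        · rcases Nat.lt_or_gt_of_ne dk with l | l
          · exact xCC h₁ h₂ k₁ x₂ k₂ x₁ hh₁ hh₂ h12 C12 C21 l l₂ h12p
          · exact xCC h₂ h₁ k₂ x₂ k₁ x₁ hh₂ hh₁ h12.symm C22 C11 l l₁ h12p
        · exact xCC h₁ h₂ k₁ x₁ x₂ k₂ hh₁ hh₂ h12 C11 C22.symm l₁ h12p l₂
        · exact xCC h₂ h₁ k₂ x₁ x₂ k₁ hh₂ hh₁ h12.symm C21 C12.symm l₂ h12p l₁
        · rcases Nat.lt_or_gt_of_ne dk with l | l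
          · exact xCC h₁ h₂ x₂ k₁ x₁ k₂ hh₁ hh₂ h12 C12.symm C21.symm h12p l₁ l
          · exact xCC h₂ h₁ x₂ k₂ x₁ k₁ hh₂ hh₁ h12.symm C22.symm C11.symm h12p l₂ l

end Endgame

end Apices

end Consts

end Summit.CriticalPhenomena.PercolationContinuityZ3.Theorems
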